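import Summits.Ventures.PercRepro.S1TriangleVCount
import Summits.Ventures.PercRepro.S1FiveCircuitX2C
import Summits.Ventures.PercRepro.S1CellCaps5

/-!
# PercRepro — the cell `(8, 21)` of the `q = 4` window, by LEMMAS V, W′ and X⁺ (p2, gen 18)

At `n = 29` LEMMA V gives `s₃ ≤ 93`, LEMMA W′ the curve `s₄ ≤ ⌊(21924 − 58·s₃)/8⌋` and LEMMA X⁺ (its `s₄`-term
dropped) the curve `s₅ ≤ ⌊(570024 − 2366·s₃)/20⌋` for the ACTUAL `s₃`. The three-cap cell inequality holds along the
curve (a kernel table of `94` cells; the twin's worst ratio `0.9656`), so the `e`-free cores of rank `8` with `29`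
points satisfy `RLS` at level `4`: the row `p = 8` now ends at `(8, 20)`.

* `cell_eight_twentyone_table` — the kernel table;
* **`c025_core_eight_twentyone`** — the core of rank `8` with `29` points.
Axioms: standard.
-/

open scoped Matroid

namespace PercRepro

namespace S1

open Set

variable {α : Type}

/-- The cells `(8, 21)` along the curves of LEMMAS W′ and X⁺: for every `s₃ ≤ 93`. -/
theorem cell_eight_twentyone_table :
    ∀ P < 94, cellOK14 8 21 P ((21924 - 58 * P) / 8) ((570024 - 2366 * P) / 20) = true := by
  decide +kernel

/-- **THE CELL `(8, 21)`**: an `e`-free core of rank `8` with `29` points satisfies `RLS` at level `4`. -/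
theorem c025_core_eight_twentyone (M : Matroid α) [M.Finite] (hR : M.eRank = (8 : ℕ)) (hn : M.E.ncard = 29)
    (hfree : ∀ e ∈ M.E, ∃ A ⊆ M.E \ {e}, e ∉ M.closure A ∧ e ∉ M.closure ((M.E \ {e}) \ A)) :
    ThmN.RLS M 8 4 := by
  have hP : {C : Set α | M.IsCircuit C ∧ C.ncard = 3}.ncard ≤ 93 := by
    have h := core_ncard_triangles_le_sq_div_nine M hfree
    rw [hn] at h
    exact h.trans (by norm_num)
  have hW := core_eight_mul_ncard_fourCircuits_add_le M hfree
  rw [hn] at hW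
  have hS : {C : Set α | M.IsCircuit C ∧ C.ncard = 4}.ncard ≤
      (21924 - 58 * {C : Set α | M.IsCircuit C ∧ C.ncard = 3}.ncard) / 8 := by
    rw [Nat.le_div_iff_mul_le (by norm_num)]
    omega
  have hX := core_twenty_mul_ncard_fiveCircuits_add_le M hfree
  rw [hn, show Nat.choose (29 - 3) 2 = 325 by decide, show Nat.choose 29 4 = 23751 by decide] at hX
  have hS5 : {C : Set α | M.IsCircuit C ∧ C.ncard = 5}.ncard ≤
      (570024 - 2366 * {C : Set α | M.IsCircuit C ∧ C.ncard = 3}.ncard) / 20 := by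
    rw [Nat.le_div_iff_mul_le (by norm_num)]
    omega
  exact rls_of_cellOK14 M 8 21 _ _ _ (by norm_num) hR hn hfree le_rfl hS hS5 (by norm_num)
    (cell_eight_twentyone_table _ (by omega))

end S1

end PercRepro
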